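import Mathlib
import HarnessLib
import Literature.Barriers.ValiantsHypothesis.MonotoneGapParseTrees
import Literature.Computability.AlgebraicComplexity.MonotoneStructure
import Summits.ValiantsHypothesis.ValiantsHypothesis.Theorems.DivisionGapZeroOneTransferFormulaToIMM
import Literature.Probability.LatticeModels.UniformStepWalk
import Summits.ValiantsHypothesis.ValiantsHypothesis.Theorems.MonotoneRestorationMonotoneRestorationQPMonotoneFormulaCover

/-!
# Monotone formula lower bounds II — formulas and counting (support file 2/3)

Support for crux item `stmt-ValiantsHypothesis-15886` (`MonotoneRestorationQP`), TTRL-lite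
variant V20269 of `stub_esymmRowSums_complexity` (negation).

* Transport of the covering property `Good[·, ·]` of
  `MonotoneRestorationMonotoneRestorationQPMonotoneFormulaCover.lean` along the gate list of a
  fan-in-two formula over `ℝ≥0` (`ArithCircuit.IsFormula`), by the leaf-weight potential of
  `DivisionGapZeroOneTransferFormulaToIMM.lean` (`depthIn_output_le`): the value of a formula of
  size `E` is good with `3E + 1` terms (`good_eval`).
* Counting lemmas: monomials of a chain product are sums of monomials of the factors
  (`mem_support_prod_range`), and the binomial anti-concentration estimate
  `binom(r, d)² (d + 1) ≤ 4^r` (`choose_sq_mul_le`, from the tree's central binomial estimate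
  `Literature.Probability.LatticeModels.UniformStep.choose_half_sq_mul_succ_le`).

References: [HrubesYehudayoffHomogeneous2011] §3; Bürgisser 2000, Def. 2.1 (formulas).
-/

-- `Summit.ValiantsHypothesis.ValiantsHypothesis.…` is the tree's single-conjunct layout (Sub = Summit).
set_option linter.dupNamespace false

noncomputable section

namespace Summit.ValiantsHypothesis.ValiantsHypothesis.Theorems.MonotoneFormulaLB

open Literature.Computability.AlgebraicComplexity
open MvPolynomial ArithCircuit
open Literature.Barriers.ValiantsHypothesis.JerrumSnir
open scoped NNReal Pointwise

variable {σ : Type} [DecidableEq σ]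

/-- `Hom[f, d]`: every monomial of `f` has degree `d` (local notation). -/
local notation3 "Hom[" f ", " d "]" =>
  ∀ m ∈ MvPolynomial.support f, Finsupp.degree m = (d : ℕ)

/-- `Cont[T, κ, θ; C]`: `C 0, …, C T` is a log-product chain of depth `T` for degree `κ` and
threshold `θ` (local notation). -/
local notation3 "Cont[" T ", " κ ", " θ "; " C "]" =>
  ∃ K : ℕ → ℕ, K 0 = (κ : ℕ) ∧ (0 < (T : ℕ) → (θ : ℕ) < 2 * K 1 ∧ K 1 ≤ θ) ∧
    (∀ j : ℕ, 0 < j → j < T → 3 * K (j + 1) ≤ 2 * K j ∧ K j < 3 * K (j + 1)) ∧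
    (∀ j : ℕ, j < T → K (j + 1) ≤ K j ∧
      ∀ m ∈ MvPolynomial.support ((C : ℕ → MvPolynomial _ ℝ≥0) j),
        Finsupp.degree m = K j - K (j + 1)) ∧
    (∀ m ∈ MvPolynomial.support ((C : ℕ → MvPolynomial _ ℝ≥0) T), Finsupp.degree m = K T) ∧
    (∀ j : ℕ, j ≤ T → (C : ℕ → MvPolynomial _ ℝ≥0) j ≠ 0)

/-- `Good[f, s]`: the log-product covering property with `s` terms (local notation). -/
local notation3 "Good[" f ", " s "]" =>
  ∀ T κ θ : ℕ, f ≠ 0 → (∀ m ∈ MvPolynomial.support f, Finsupp.degree m = κ) →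
    2 * κ ≤ 3 * θ + 2 → θ < κ → 3 ^ T ≤ θ + 1 →
    ∃ L : List (ℕ → MvPolynomial _ ℝ≥0), L.length ≤ (s : ℕ) ∧
      (∀ C ∈ L, Cont[T, κ, θ; C] ∧
        MvPolynomial.support (∏ j ∈ Finset.range (T + 1), C j) ⊆ MvPolynomial.support f) ∧
      (∀ m ∈ MvPolynomial.support f, ∃ C ∈ L,
        m ∈ MvPolynomial.support (∏ j ∈ Finset.range (T + 1), C j))

/-! ### Transport along a fan-in-two formula (the potential argument of `FormulaToIMM`) -/

section Weights

open Summit.ValiantsHypothesis.ValiantsHypothesis.Theorems.DivisionGapZeroOneTransfer.FormulaToIMM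

/-- `tv⟦gs⟧` (local notation, as in `FormulaToIMM`): the reduced leaf weights of the gates. -/
local notation3 "tv⟦" gs "⟧" => List.foldl (fun (ts : List ℕ) (g : Gate _ _) =>
  ts ++ [(List.map (fun u => Operand.depthIn ts u + 1) (Gate.args g)).sum + 1]) [] gs

/-- **One gate** of fan-in `≤ 2`: empty sum / product (`0`, `1`), scaling, binary weighted sum,
unary / binary product. [folklore] -/
theorem good_gate (vals : List (MvPolynomial σ ℝ≥0)) (ts : List ℕ) (g : Gate ℝ≥0 σ)
    (hg : g.fanIn ≤ 2)
    (ih : ∀ u : Operand ℝ≥0 σ, Good[Operand.eval vals u, Operand.depthIn ts u + 1]) :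
    Good[Gate.eval vals g, ((Gate.args g).map fun u => Operand.depthIn ts u + 1).sum + 1 + 1] := by
  cases g with
  | sum args =>
    rcases args with _ | ⟨⟨a, u⟩, _ | ⟨⟨b, v⟩, _ | ⟨w, rest⟩⟩⟩
    · have hval : Gate.eval vals (Gate.sum ([] : List (ℝ≥0 × Operand ℝ≥0 σ))) = 0 := by
        simp [Gate.eval]
      rw [hval]
      exact good_zero _
    · have hval : Gate.eval vals (Gate.sum [(a, u)]) = a • Operand.eval vals u := by
        simp [Gate.eval]
      rw [hval]
      exact good_mono (good_smul a (ih u)) (by simp [Gate.args])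
    · have hval : Gate.eval vals (Gate.sum [(a, u), (b, v)]) =
          a • Operand.eval vals u + b • Operand.eval vals v := by
        simp [Gate.eval]
      rw [hval]
      exact good_mono (good_add (good_smul a (ih u)) (good_smul b (ih v)))
        (by simp [Gate.args]; omega)
    · simp [Gate.fanIn, Gate.args] at hg
  | prod args =>
    rcases args with _ | ⟨u, _ | ⟨v, _ | ⟨w, rest⟩⟩⟩
    · have hval : Gate.eval vals (Gate.prod ([] : List (Operand ℝ≥0 σ))) = C 1 := by
        simp [Gate.eval]
      rw [hval]
      exact good_C 1 _
    · have hval : Gate.eval vals (Gate.prod [u]) = Operand.eval vals u := by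
        simp [Gate.eval]
      rw [hval]
      exact good_mono (ih u) (by simp [Gate.args])
    · have hval : Gate.eval vals (Gate.prod [u, v]) = Operand.eval vals u * Operand.eval vals v := by
        simp [Gate.eval]
      rw [hval]
      exact good_mono (good_mul (ih u) (ih v) (Nat.succ_pos _) (Nat.succ_pos _))
        (by simp [Gate.args]; omega)
    · simp [Gate.fanIn, Gate.args] at hg

/-- **All gates**: along a fan-in-two gate list over `ℝ≥0`, the value of every operand is good
with its leaf weight (a junk reference is the leaf `0`). [folklore] -/
theorem good_operand (gs : List (Gate ℝ≥0 σ)) : (∀ g ∈ gs, g.fanIn ≤ 2) →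
    ∀ u : Operand ℝ≥0 σ, Good[Operand.eval (gateValues gs) u, Operand.depthIn tv⟦gs⟧ u + 1] := by
  induction gs using List.reverseRecOn with
  | nil =>
    intro _ u
    cases u with
    | var i => exact good_X i
    | const c => exact good_C c _
    | gate j => simp [Operand.eval]
  | append_singleton gs g ih =>
    intro h2 u
    have h2' : ∀ g' ∈ gs, g'.fanIn ≤ 2 := fun g' hg' => h2 g' (List.mem_append_left _ hg')
    cases u with
    | var i => exact good_X i
    | const c => exact good_C c _
    | gate j =>
      rw [Operand.eval_gate, Operand.depthIn.eq_3, gateValues_append_singleton,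
        tv_append_singleton]
      rcases Nat.lt_trichotomy j gs.length with hj | rfl | hj
      · rw [List.getD_append tv⟦gs⟧ _ 0 j (by rw [tv_length]; exact hj),
          List.getD_append (gateValues gs) _ 0 j (by simpa using hj)]
        exact ih h2' (.gate j)
      · rw [List.getD_append_right tv⟦gs⟧ _ 0 _ (by rw [tv_length]),
          List.getD_append_right (gateValues gs) _ 0 _ (by simp), gateValues_length, tv_length,
          Nat.sub_self]
        simpa using good_gate _ _ g (h2 g (by simp)) (ih h2')
      · rw [List.getD_eq_default _ (0 : ℕ)
            (by rw [List.length_append, List.length_singleton, tv_length]; omega),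
          List.getD_eq_default _ (0 : MvPolynomial σ ℝ≥0) (by simp; omega)]
        exact good_zero (σ := σ) 1

/-- **The covering property of a formula**: the value of a fan-in-two formula `P` over `ℝ≥0`
is good with `3 · size + 1` terms. [folklore] -/
theorem good_eval (P : ArithCircuit ℝ≥0 σ) (hF : P.IsFormula) (h2 : P.IsFanInTwo) :
    Good[P.eval, 3 * P.size + 1] :=
  good_mono (good_operand P.gates h2 P.output) (depthIn_output_le P hF h2)

end Weights

/-! ### Counting: monomials of a chain product, binomial estimates -/

omit [DecidableEq σ] in
/-- Supports of `ℕ`-valued finitely supported functions add as unions. [folklore] -/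
theorem nat_support_add {α : Type} [DecidableEq α] (a b : α →₀ ℕ) :
    (a + b).support = a.support ∪ b.support := by
  ext x
  simp only [Finsupp.mem_support_iff, Finsupp.add_apply, Finset.mem_union]
  omega

omit [DecidableEq σ] in
/-- Supports of `ℕ`-valued finitely supported functions add as unions (finite sums).
[folklore] -/
theorem nat_support_sum {α ι : Type} [DecidableEq α] [DecidableEq ι] (s : Finset ι)
    (a : ι → α →₀ ℕ) :
    (∑ j ∈ s, a j).support = s.biUnion fun j => (a j).support := by
  classical
  induction s using Finset.induction_on with
  | empty => simp
  | insert i s hi ih => rw [Finset.sum_insert hi, Finset.biUnion_insert, nat_support_add, ih]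

/-- Over `ℝ≥0`, the monomials of a product `C 0 ⋯ C T` are exactly the sums of monomials of the
factors. [folklore] -/
theorem mem_support_prod_range (C : ℕ → MvPolynomial σ ℝ≥0) (T : ℕ) (m : σ →₀ ℕ) :
    m ∈ (∏ j ∈ Finset.range (T + 1), C j).support ↔
      ∃ a : ℕ → σ →₀ ℕ, (∀ j, j ≤ T → a j ∈ (C j).support) ∧
        ∑ j ∈ Finset.range (T + 1), a j = m := by
  induction T generalizing m with
  | zero =>
    simp only [zero_add, Finset.prod_range_one, Finset.sum_range_one, Nat.le_zero]
    exact ⟨fun h => ⟨fun _ => m, fun j hj => by subst hj; exact h, rfl⟩,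
      fun ⟨a, ha, hm⟩ => hm ▸ ha 0 rfl⟩
  | succ T ih =>
    rw [Finset.prod_range_succ, support_mul_eq, Finset.mem_add]
    constructor
    · rintro ⟨x, hx, y, hy, rfl⟩
      obtain ⟨a, ha, rfl⟩ := (ih x).1 hx
      refine ⟨Function.update a (T + 1) y, fun j hj => ?_, ?_⟩
      · rcases Nat.lt_or_eq_of_le hj with hj | rfl
        · rw [Function.update_of_ne (by omega)]; exact ha j (by omega)
        · rw [Function.update_self]; exact hy
      · rw [Finset.sum_range_succ, Function.update_self]
        congr 1
        exact Finset.sum_congr rfl fun j hj =>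
          Function.update_of_ne (by simp at hj; omega) _ _
    · rintro ⟨a, ha, rfl⟩
      refine ⟨∑ j ∈ Finset.range (T + 1), a j, (ih _).2 ⟨a, fun j hj => ha j (by omega), rfl⟩,
        a (T + 1), ha (T + 1) le_rfl, ?_⟩
      exact (Finset.sum_range_succ a (T + 1)).symm

omit [DecidableEq σ] in
/-- Anti-concentration of the binomial coefficients: `binom(r, d)² (d + 1) ≤ 4^r`. [folklore] -/
theorem choose_sq_mul_le (r d : ℕ) : (r.choose d) ^ 2 * (d + 1) ≤ 4 ^ r := by
  rcases lt_or_ge r d with h | h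
  · rw [Nat.choose_eq_zero_of_lt h]; simp
  · calc (r.choose d) ^ 2 * (d + 1) ≤ (r.choose (r / 2)) ^ 2 * (r + 1) :=
        Nat.mul_le_mul (Nat.pow_le_pow_left (Nat.choose_le_middle d r) 2) (by omega)
      _ ≤ 4 ^ r := Literature.Probability.LatticeModels.UniformStep.choose_half_sq_mul_succ_le r

omit [DecidableEq σ] in
/-- Product form of `choose_sq_mul_le`. [folklore] -/
theorem prod_choose_sq_mul_le {ι : Type} (s : Finset ι) (r d : ι → ℕ) :
    (∏ j ∈ s, (r j).choose (d j)) ^ 2 * ∏ j ∈ s, (d j + 1) ≤ 4 ^ (∑ j ∈ s, r j) := by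
  rw [← Finset.prod_pow, ← Finset.prod_mul_distrib, ← Finset.prod_pow_eq_pow_sum]
  exact Finset.prod_le_prod' fun j _ => choose_sq_mul_le (r j) (d j)

/-! ### Rows of monomials in the matrix variables `x_{i,j}` -/

section Rows

variable {n : ℕ}

/-- A row-multilinear monomial has as many rows as its degree. [folklore] -/
theorem card_rows_eq_degree {m : Fin n × Fin n →₀ ℕ} (h : ∀ i, rowDegrees m i ≤ 1) :
    (rowDegrees m).support.card = Finsupp.degree m := by
  rw [← degree_rowDegrees m, Finsupp.degree_apply, Finset.card_eq_sum_ones]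
  refine Finset.sum_congr rfl fun i hi => ?_
  have := h i
  have h0 := Finsupp.mem_support_iff.1 hi
  omega

/-- Rows of a sum of monomials. [folklore] -/
theorem rows_sum {ι : Type} [DecidableEq ι] (s : Finset ι) (a : ι → Fin n × Fin n →₀ ℕ) :
    (rowDegrees (∑ j ∈ s, a j)).support = s.biUnion fun j => (rowDegrees (a j)).support := by
  rw [rowDegrees, Finsupp.mapDomain_finsetSum, nat_support_sum]
  rfl

/-- Row degrees of a sum of monomials, pointwise. [folklore] -/
theorem rowDegrees_sum_apply {ι : Type} (s : Finset ι) (a : ι → Fin n × Fin n →₀ ℕ)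
    (i : Fin n) : rowDegrees (∑ j ∈ s, a j) i = ∑ j ∈ s, rowDegrees (a j) i := by
  rw [rowDegrees, Finsupp.mapDomain_finsetSum, Finsupp.finsetSum_apply]
  rfl

end Rows

end Summit.ValiantsHypothesis.ValiantsHypothesis.Theorems.MonotoneFormulaLB

namespace Summit.ValiantsHypothesis.ValiantsHypothesis.Theorems

/-- Registered helper stub of the TTRL variant V20269 (headline of this support file): the
binomial anti-concentration estimate `binom(r, d)² (d + 1) ≤ 4^r`. [folklore] -/
theorem stub_var20269_chooseSqMulLe (r d : ℕ) : (r.choose d) ^ 2 * (d + 1) ≤ 4 ^ r :=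
  MonotoneFormulaLB.choose_sq_mul_le r d

end Summit.ValiantsHypothesis.ValiantsHypothesis.Theorems

end
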